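import Summits.AtomisticToContinuum.Crystallization.Theorems.OverbindingBudgetElasticSplitDoorBridge

/-!
# OverbindingBudget — the bridge piece B₁ `CleanTwoShell` cut at charge-freeness; its recurrence half PROVED (lens-4 g28, part VIII)

Helper file (`--supports stmt-AtomisticToContinuum-31280`).  `…ElasticSplitDoorBridge` left two bridge pieces between an L_opt texture and
N's door sets; the first, B₁ `CleanTwoShell T₀ D` (every atom (1/16, 9/10, 1)-two-shell-good), is cut here at the CHARGE currency of
`SparseCharge`: «charged» = `¬ IsChargeFree (1/100) y i` (Literature `BondGraph`: exactly twelve bonds in the scale-free bond graph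
`dist ≤ (1 + 1/100)·min(nn_j, nn_k)` and ring number `4` on every bond — a bond-COMBINATORIAL predicate, not two-shell geometry).

* `ChargeFreeNear Y q ε` (§1): some cube chunk of `Y`, injectively enumerated, has a `4`-DEEP CHARGE-FREE site `y i` whose re-rooted texture
  `Y − y i` is two-way `ε`-matched to `Y − q` on `B(0, 3)` — «the environment of `q` is `ε`-close to a charge-free environment».
* **B₁ᵃ `LimitChargeFree T₀ D`** := in a clean texture with sparse charge EVERY site has charge-free environments `ε`-close to its own, for
  every `ε > 0`.  **PROVED for all `T₀, D`** (`limitChargeFree_holds`, §3): uniform recurrence (a binder of `CleanClass`) re-roots the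
  `(‖q‖+5)`-patch of the rooted texture within `G` of every site, so a cube of side `s(m+1)`, `s = 2G + 2‖q‖ + 12`, holds `m³` distinct `4`-deep
  sites whose environments are `ε`-close to that of `q` (§2, the grid of `le_card_deep` at spacing `s`); were they all charged, the chunk would
  carry `≥ ℓ³/(8s³)` charged sites cofinally — `DenseCharge (1/(8s³)) Y`, contradicting `SparseCharge`.  (Chargedness is NOT an open
  condition — a thirteenth neighbour or a link edge exactly at threshold — so «one charged site recurs with positive density» is false as
  stated; the limit form is what recurrence gives.)
* **B₁ᵇ `ChargeFreeRigidity T₀ D`** (§1) := a site of an uncompressed clean texture all of whose `ε`-neighbourhoods (in the matching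
  topology) contain charge-free environments is (1/16, 9/10, 1)-two-shell-good — ROBUST KISSING RIGIDITY at tolerance `1/100` (the
  `θ`-tolerant Flatley–Tarasov–Taylor–Theil Thm 4 / Hales 2012 Lemmas 9–10; the tree's `FlatleyEtAl2013_maxContacts`,
  `Hales2012_contactGraphFccOrHcp_holds`, `KissingRigidity` are the EXACT-contact versions) plus the second shell from the neighbours'
  shells.  UNDECIDED·TRUE-type, certificate-class. [piece]
* SEAM `cleanTwoShell_of_pieces : LimitChargeFree T₀ D → ChargeFreeRigidity T₀ D → CleanTwoShell T₀ D` (so B₁ ⟸ B₁ᵇ outright), and the cone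
  `rdef_of_grossU_doorPeriodic_rigidity Λ : GrossCleanBallsU (1/250) 10 → ChargedEnergyGap → CompressedVirialLaw (1/250) 10 →
  ChargeFreeRigidity (1/250) 10 → CleanCharted (1/250) 10 → DoorPeriodic Λ → PeriodicStrainedCubes Λ (1/250) 10 → CleanlessExcessT →
  CoherentResidual 10 → RobustDefectLimitWindows`.
-/

namespace Summit.AtomisticToContinuum.Crystallization.Theorems.OverbindingBudgetCleanTwoShellCut

open scoped Classical
open Literature.MathematicalPhysics.StatisticalMechanics (UniformlyDiscrete Match)
open Literature.Geometry.DiscreteGeometry (IsTwoShellGoodSet IsChargeFree)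
open Summit.AtomisticToContinuum.Crystallization.Theses.OverbindingBudget (RobustDefectLimitWindows)
open Summit.AtomisticToContinuum.Crystallization.Theses.PricedLinkCensus (ChargedEnergyGap)
open Summit.AtomisticToContinuum.Crystallization.Theorems.OverbindingBudgetGradedBareness (CleanlessExcessT)
open Summit.AtomisticToContinuum.Crystallization.Theorems.OverbindingBudgetCoherentCut (CoherentResidual)
open Summit.AtomisticToContinuum.Crystallization.Theorems.OverbindingBudgetUniformCutStatements (GrossCleanBallsU)
open Summit.AtomisticToContinuum.Crystallization.Theorems.OverbindingBudgetExcessInstability (finite_inter_cube)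
open Summit.AtomisticToContinuum.Crystallization.Theorems.OverbindingBudgetEdgeRelaxationStatements (CleanClass)
open Summit.AtomisticToContinuum.Crystallization.Theorems.OverbindingBudgetElasticSplitStatements (chargedCount DenseCharge SparseCharge)
open Summit.AtomisticToContinuum.Crystallization.Theorems.OverbindingBudgetElasticSplitDilation (enum enum_injective)
open Summit.AtomisticToContinuum.Crystallization.Theorems.OverbindingBudgetElasticSplitScale (HasCompressedScale CompressedVirialLaw)
open Summit.AtomisticToContinuum.Crystallization.Theorems.OverbindingBudgetElasticSplitPeriodic (PeriodicStrainedCubes)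
open Summit.AtomisticToContinuum.Crystallization.Theorems.OverbindingBudgetElasticSplitDoorBridge (CleanTwoShell CleanCharted
  rdef_of_grossU_doorPeriodic)
open Summit.AtomisticToContinuum.Crystallization.Theorems.ChartedPlanarOrderDoorLayered (DoorPeriodic)

/-! ## §1 The statements -/

/-- **`ChargeFreeNear Y q ε`**: some cube chunk `Y ∩ Q(c, ℓ)`, injectively enumerated by `y : Fin N → ℝ³`, has a site `y i` that is `4`-deep
in the cube, CHARGE-FREE in the chunk (`IsChargeFree (1/100) y i`, the currency of `SparseCharge`), and whose re-rooted texture `Y − y i`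
is two-way `ε`-matched to `Y − q` on `B(0, 3)`. -/
def ChargeFreeNear (Y : Set (EuclideanSpace ℝ (Fin 3))) (q : EuclideanSpace ℝ (Fin 3)) (ε : ℝ) : Prop :=
  ∃ c : EuclideanSpace ℝ (Fin 3), ∃ ℓ : ℝ, ∃ N : ℕ, ∃ y : Fin N → EuclideanSpace ℝ (Fin 3), ∃ i : Fin N,
    Function.Injective y ∧ Set.range y = Y ∩ {z | ∀ j : Fin 3, c j ≤ z j ∧ z j < c j + ℓ} ∧
    (∀ j : Fin 3, c j + 4 ≤ y i j ∧ y i j + 4 ≤ c j + ℓ) ∧ IsChargeFree (1 / 100 : ℝ) y i ∧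
    Match ε 3 0 ((fun p => p - y i) '' Y) ((fun p => p - q) '' Y)

/-- **B₁ᵃ · `LimitChargeFree T₀ D`**: in a clean texture with sparse charge, every site has charge-free environments `ε`-close to its own,
for every `ε > 0`.  PROVED below for all parameters. [piece] -/
def LimitChargeFree (T₀ D : ℝ) : Prop :=
  ∀ Y : Set (EuclideanSpace ℝ (Fin 3)), CleanClass T₀ D Y → SparseCharge Y → ∀ q ∈ Y, ∀ ε : ℝ, 0 < ε → ChargeFreeNear Y q ε

/-- **B₁ᵇ · `ChargeFreeRigidity T₀ D`**: a site of an uncompressed clean texture that is a limit of charge-free environments is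
(1/16, 9/10, 1)-two-shell-good — robust kissing rigidity at tolerance `1/100` plus the second shell.  UNDECIDED·TRUE-type (certificate). [piece] -/
def ChargeFreeRigidity (T₀ D : ℝ) : Prop :=
  ∀ Y : Set (EuclideanSpace ℝ (Fin 3)), CleanClass T₀ D Y → ¬ HasCompressedScale T₀ Y →
    ∀ q ∈ Y, (∀ ε : ℝ, 0 < ε → ChargeFreeNear Y q ε) → IsTwoShellGoodSet (1 / 16) (9 / 10) 1 Y q

/-- **Seam.** `LimitChargeFree → ChargeFreeRigidity → CleanTwoShell` (local optimality and unstrainedness are not used). [this file] -/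
theorem cleanTwoShell_of_pieces {T₀ D : ℝ} (ha : LimitChargeFree T₀ D) (hb : ChargeFreeRigidity T₀ D) : CleanTwoShell T₀ D :=
  fun Y hY hnc hsc _ _ q hq => hb Y hY hnc q hq fun ε hε => ha Y hY hsc q hq ε hε

/-! ## §2 Lemmas: the range of the enumeration, re-rooting a matching -/

/-- The canonical enumeration of a chunk has the chunk as its range. [folklore] -/
theorem range_enum (F : Finset (EuclideanSpace ℝ (Fin 3))) : Set.range (enum F) = ↑F := by
  ext x
  constructor
  · rintro ⟨i, rfl⟩
    exact (F.equivFin.symm i).2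
  · intro hx
    refine ⟨F.equivFin ⟨x, hx⟩, ?_⟩
    simp [enum]

/-- **Re-rooting.**  If `Y − g` is `ε'`-matched to `Y` on `B(0, R)` and `|p − g − q| ≤ ε'`, then `Y − p` is `2ε'`-matched to
`Y − q` on `B(0, 3)`, provided `‖q‖ + 3 + ε' ≤ R`. [this file] -/
theorem match_reroot {Y : Set (EuclideanSpace ℝ (Fin 3))} {g p q : EuclideanSpace ℝ (Fin 3)} {ε' R : ℝ}
    (hM : Match ε' R 0 ((fun x => x - g) '' Y) Y) (hpd : dist (p - g) q ≤ ε') (hε' : 0 ≤ ε') (hR : ‖q‖ + 3 + ε' ≤ R) :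
    Match (2 * ε') 3 0 ((fun x => x - p) '' Y) ((fun x => x - q) '' Y) := by
  have hpgq : ‖p - g - q‖ ≤ ε' := by rwa [← dist_eq_norm]
  constructor
  · rintro s ⟨y, hy, rfl⟩ hs
    have hs' : ‖y - q‖ ≤ 3 := by rwa [dist_zero_right] at hs
    have hy0 : dist y 0 ≤ R := by
      rw [dist_zero_right]
      have : ‖y‖ ≤ ‖y - q‖ + ‖q‖ := norm_le_norm_sub_add y q
      linarith
    obtain ⟨a, ⟨y', hy', rfl⟩, hd⟩ := hM.1 y hy hy0
    refine ⟨y' - p, ⟨y', hy', rfl⟩, ?_⟩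
    rw [dist_eq_norm] at hd ⊢
    have e : y' - p - (y - q) = (y' - g - y) - (p - g - q) := by abel
    rw [e]
    exact (norm_sub_le _ _).trans (by linarith)
  · rintro a ⟨y', hy', rfl⟩ ha
    have ha' : ‖y' - p‖ ≤ 3 := by rwa [dist_zero_right] at ha
    have hpg : ‖p - g‖ ≤ ε' + ‖q‖ := by
      have : ‖p - g‖ ≤ ‖p - g - q‖ + ‖q‖ := norm_le_norm_sub_add (p - g) q
      linarith
    have hy0 : dist (y' - g) 0 ≤ R := by
      rw [dist_zero_right]
      have e : y' - g = (y' - p) + (p - g) := by abel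
      rw [e]
      exact (norm_add_le _ _).trans (by linarith)
    obtain ⟨s, hs, hd⟩ := hM.2 (y' - g) ⟨y', hy', rfl⟩ hy0
    refine ⟨s - q, ⟨s, hs, rfl⟩, ?_⟩
    rw [dist_eq_norm] at hd ⊢
    have e : y' - p - (s - q) = (y' - g - s) - (p - g - q) := by abel
    rw [e]
    exact (norm_sub_le _ _).trans (by linarith)

/-! ## §3 B₁ᵃ proved: recurrence and sparse charge put charge-free environments near every environment -/

/-- **`LimitChargeFree T₀ D` holds for all parameters.** [this file] -/
theorem limitChargeFree_holds (T₀ D : ℝ) : LimitChargeFree T₀ D := by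
  intro Y hY hsc q hq ε hε
  by_contra hno
  have hUD : UniformlyDiscrete Y := hY.1
  have hcov : ∀ z : EuclideanSpace ℝ (Fin 3), ∃ w ∈ Y, dist z w ≤ 9 / 10 := hY.2.2.2.1
  -- the precision and radius of the recurrence
  set ε' : ℝ := min (ε / 2) (1 / 2) with hε'def
  have hε'pos : 0 < ε' := lt_min (by linarith) (by norm_num)
  have hε'le : ε' ≤ 1 / 2 := min_le_right _ _
  have hε'ε : 2 * ε' ≤ ε := by have := min_le_left (ε / 2) (1 / 2); linarith
  set R : ℝ := ‖q‖ + 5 with hRdef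
  obtain ⟨G, hG⟩ := hY.2.2.1 R ε' hε'pos
  set G₀ : ℝ := max G 0 with hG₀def
  have hG₀ : 0 ≤ G₀ := le_max_right _ _
  have hGG₀ : G ≤ G₀ := le_max_left _ _
  have hq0 : 0 ≤ ‖q‖ := norm_nonneg _
  -- the spacing and the density
  set s : ℝ := 2 * G₀ + 2 * ‖q‖ + 12 with hsdef
  have hs : 0 < s := by positivity
  set ρ : ℝ := 1 / (8 * s ^ 3) with hρdef
  have hρ : 0 < ρ := by positivity
  apply hsc ρ hρ
  -- DenseCharge ρ Y
  intro ℓ₀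
  set m : ℕ := ⌈ℓ₀ / s⌉₊ + 1 with hmdef
  have hm1 : (1 : ℝ) ≤ m := by
    have : (1 : ℕ) ≤ m := Nat.le_add_left 1 _
    exact_mod_cast this
  set ℓ : ℝ := s * ((m : ℝ) + 1) with hℓdef
  have hℓ₀ : ℓ₀ ≤ ℓ := by
    have h1 : ℓ₀ / s ≤ ⌈ℓ₀ / s⌉₊ := Nat.le_ceil _
    have h2 : (⌈ℓ₀ / s⌉₊ : ℝ) ≤ m := by
      have : ⌈ℓ₀ / s⌉₊ ≤ m := Nat.le_succ _
      exact_mod_cast this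
    have h3 : ℓ₀ / s ≤ (m : ℝ) + 1 := by linarith
    have h4 : ℓ₀ ≤ s * (ℓ₀ / s) := by rw [mul_div_cancel₀ _ hs.ne']
    calc ℓ₀ ≤ s * (ℓ₀ / s) := h4
      _ ≤ s * ((m : ℝ) + 1) := mul_le_mul_of_nonneg_left h3 hs.le
  have hℓpos : 0 < ℓ := by positivity
  -- the chunk and its enumeration
  set c : EuclideanSpace ℝ (Fin 3) := 0 with hcdef
  have hci : ∀ i : Fin 3, c i = 0 := fun i => rfl
  have hfin := finite_inter_cube hUD c hℓpos.le
  set F : Finset (EuclideanSpace ℝ (Fin 3)) := hfin.toFinset with hFdef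
  have hF : (↑F : Set (EuclideanSpace ℝ (Fin 3))) = Y ∩ {z | ∀ i : Fin 3, c i ≤ z i ∧ z i < c i + ℓ} := hfin.coe_toFinset
  refine ⟨ℓ, hℓ₀, c, F.card, enum F, enum_injective F, by rw [range_enum, hF], ?_⟩
  -- the grid, its nearby sites, their re-rootings
  set z : (Fin 3 → Fin m) → EuclideanSpace ℝ (Fin 3) :=
    fun k => WithLp.toLp 2 (fun i => (G₀ + ‖q‖ + 6) + s * ((k i : ℕ) : ℝ)) with hzdef
  have hzi : ∀ k i, z k i = (G₀ + ‖q‖ + 6) + s * ((k i : ℕ) : ℝ) := by intro k i; simp [hzdef]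
  choose w hwY hwd using fun k => hcov (z k)
  choose g hgY hgd hM using fun k => hG (w k) (hwY k)
  have key : ∀ k, ∃ p ∈ Y, dist (p - g k) q ≤ ε' := by
    intro k
    have hqR : dist q 0 ≤ R := by rw [dist_zero_right]; linarith
    obtain ⟨a, ⟨p, hp, rfl⟩, hd⟩ := (hM k).1 q hq hqR
    exact ⟨p, hp, hd⟩
  choose p hpY hpd using key
  -- coordinates of the re-rooted sites relative to the grid
  have hpz : ∀ k, dist (p k) (z k) ≤ G₀ + ‖q‖ + 2 := by
    intro k
    have h1 : dist (p k) (g k + q) ≤ ε' := by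
      have e : dist (p k) (g k + q) = dist (p k - g k) q := by rw [dist_eq_norm, dist_eq_norm]; congr 1; abel
      rw [e]; exact hpd k
    have h2 : dist (g k + q) (g k) = ‖q‖ := by rw [dist_eq_norm]; simp
    have h3 : dist (g k) (w k) ≤ G₀ := (hgd k).trans hGG₀
    have h4 : dist (w k) (z k) ≤ 9 / 10 := by rw [dist_comm]; exact hwd k
    calc dist (p k) (z k) ≤ dist (p k) (w k) + dist (w k) (z k) := dist_triangle _ _ _
      _ ≤ dist (p k) (g k + q) + dist (g k + q) (g k) + dist (g k) (w k) + dist (w k) (z k) := by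
          linarith [dist_triangle4 (p k) (g k + q) (g k) (w k)]
      _ ≤ ε' + ‖q‖ + G₀ + 9 / 10 := by rw [h2]; linarith
      _ ≤ G₀ + ‖q‖ + 2 := by linarith
  have hco : ∀ k i, -(G₀ + ‖q‖ + 2) ≤ p k i - z k i ∧ p k i - z k i ≤ G₀ + ‖q‖ + 2 := by
    intro k i
    have h : dist (p k i) (z k i) ≤ G₀ + ‖q‖ + 2 := (PiLp.dist_apply_le (p k) (z k) i).trans (hpz k)
    rw [Real.dist_eq, abs_le] at h
    exact h
  have hkm : ∀ (k : Fin 3 → Fin m) (i : Fin 3), ((k i : ℕ) : ℝ) + 1 ≤ m := fun k i => by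
    have h : (k i : ℕ) + 1 ≤ m := (k i).isLt
    exact_mod_cast h
  -- deepness
  have hdeep : ∀ k i, c i + 4 ≤ p k i ∧ p k i + 4 ≤ c i + ℓ := by
    intro k i
    have h1 := hco k i
    have h2 := hzi k i
    have h3 := hkm k i
    have h0 : (0 : ℝ) ≤ ((k i : ℕ) : ℝ) := Nat.cast_nonneg _
    have hsk : 0 ≤ s * ((k i : ℕ) : ℝ) := mul_nonneg hs.le h0
    have h4 : s * (((k i : ℕ) : ℝ) + 1) ≤ s * (m : ℝ) := mul_le_mul_of_nonneg_left h3 hs.le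
    rw [hci]
    constructor
    · linarith [h1.1, h2, hsk]
    · linarith [h1.2, h2, h4, hℓdef, hsdef, hs.le]
  have hcube : ∀ k, p k ∈ Y ∩ {x | ∀ i : Fin 3, c i ≤ x i ∧ x i < c i + ℓ} := fun k =>
    ⟨hpY k, fun i => ⟨by linarith [(hdeep k i).1], by linarith [(hdeep k i).2]⟩⟩
  -- injectivity of k ↦ p k
  have hinj : Function.Injective p := by
    intro k k' hkk'
    by_contra hne
    obtain ⟨i, hi⟩ := Function.ne_iff.1 hne
    have hi' : (k i : ℕ) ≠ (k' i : ℕ) := fun h => hi (Fin.ext h)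
    have e : z k i - z k' i = (z k i - p k i) + (p k' i - z k' i) := by rw [hkk']; ring
    have hb : -(2 * (G₀ + ‖q‖ + 2)) ≤ z k i - z k' i ∧ z k i - z k' i ≤ 2 * (G₀ + ‖q‖ + 2) := by
      have h1 := hco k i
      have h2 := hco k' i
      rw [e]
      constructor <;> linarith [h1.1, h1.2, h2.1, h2.2]
    have hd : z k i - z k' i = s * (((k i : ℕ) : ℝ) - ((k' i : ℕ) : ℝ)) := by rw [hzi, hzi]; ring
    have hslt : 2 * (G₀ + ‖q‖ + 2) < s := by rw [hsdef]; linarith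
    rcases lt_or_gt_of_ne hi' with hlt | hlt
    · have h : ((k i : ℕ) : ℝ) + 1 ≤ ((k' i : ℕ) : ℝ) := by exact_mod_cast hlt
      have : z k i - z k' i ≤ -s := by rw [hd]; nlinarith
      linarith [hb.1]
    · have h : ((k' i : ℕ) : ℝ) + 1 ≤ ((k i : ℕ) : ℝ) := by exact_mod_cast hlt
      have : s ≤ z k i - z k' i := by rw [hd]; nlinarith
      linarith [hb.2]
  -- each p k is an enumerated site, and it is CHARGED (else `ChargeFreeNear Y q ε`)
  have hidx : ∀ k, ∃ i : Fin F.card, enum F i = p k := by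
    intro k
    have h : p k ∈ Set.range (enum F) := by rw [range_enum, hF]; exact hcube k
    exact h
  choose idx hidx using hidx
  have hcharged : ∀ k, ¬ IsChargeFree (1 / 100 : ℝ) (enum F) (idx k) := by
    intro k hfree
    apply hno
    refine ⟨c, ℓ, F.card, enum F, idx k, enum_injective F, by rw [range_enum, hF], ?_, hfree, ?_⟩
    · intro j; rw [hidx k]; exact hdeep k j
    · rw [hidx k]
      have hRε : ‖q‖ + 3 + ε' ≤ R := by rw [hRdef]; linarith
      exact (match_reroot (hM k) (hpd k) hε'pos.le hRε).mono hε'ε le_rfl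
  -- counting: m³ charged sites, and ρ ℓ³ ≤ m³
  set f : (Fin 3 → Fin m) → {i : Fin F.card // ¬ IsChargeFree (1 / 100 : ℝ) (enum F) i} := fun k => ⟨idx k, hcharged k⟩ with hfdef
  have hfinj : Function.Injective f := by
    intro k k' hkk'
    have h1 : idx k = idx k' := by
      have := congrArg Subtype.val hkk'
      simpa [hfdef] using this
    apply hinj
    rw [← hidx k, ← hidx k', h1]
  have hcard : Nat.card (Fin 3 → Fin m) ≤ chargedCount (enum F) := by
    unfold chargedCount
    exact Nat.card_le_card_of_injective f hfinj
  have hu : Nat.card (Fin 3 → Fin m) = m ^ 3 := by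
    rw [Nat.card_eq_fintype_card, Fintype.card_fun, Fintype.card_fin, Fintype.card_fin]
  rw [hu] at hcard
  have hcardR : ((m : ℝ)) ^ 3 ≤ (chargedCount (enum F) : ℝ) := by exact_mod_cast hcard
  have hρℓ : ρ * ℓ ^ 3 ≤ (m : ℝ) ^ 3 := by
    rw [hρdef, hℓdef]
    have hs3 : 0 < s ^ 3 := by positivity
    have e : 1 / (8 * s ^ 3) * (s * ((m : ℝ) + 1)) ^ 3 = ((m : ℝ) + 1) ^ 3 / 8 := by
      field_simp
    rw [e]
    have hm2 : (m : ℝ) + 1 ≤ 2 * m := by linarith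
    have h0 : (0 : ℝ) ≤ (m : ℝ) + 1 := by linarith
    have h8 : ((m : ℝ) + 1) ^ 3 ≤ (2 * m) ^ 3 := by
      exact pow_le_pow_left₀ h0 hm2 3
    nlinarith [h8]
  exact hρℓ.trans hcardR

/-! ## §4 The cone with B₁ replaced by its rigidity half -/

/-- **RDEF cone with the charge-free rigidity piece** (every `Λ`): `GrossCleanBallsU (1/250) 10 → ChargedEnergyGap →
CompressedVirialLaw (1/250) 10 → ChargeFreeRigidity (1/250) 10 → CleanCharted (1/250) 10 → DoorPeriodic Λ → PeriodicStrainedCubes Λ (1/250) 10 →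
CleanlessExcessT → CoherentResidual 10 → RobustDefectLimitWindows`. [this file] -/
theorem rdef_of_grossU_doorPeriodic_rigidity (Λ : ℝ) (hG : GrossCleanBallsU (1 / 250) 10) (hCEG : ChargedEnergyGap)
    (hC : CompressedVirialLaw (1 / 250) 10) (hB : ChargeFreeRigidity (1 / 250) 10) (h₂ : CleanCharted (1 / 250) 10) (hD : DoorPeriodic Λ)
    (hE : PeriodicStrainedCubes Λ (1 / 250) 10) (hCE : CleanlessExcessT) (hR : CoherentResidual 10) : RobustDefectLimitWindows :=
  rdef_of_grossU_doorPeriodic Λ hG hCEG hC (cleanTwoShell_of_pieces (limitChargeFree_holds (1 / 250) 10) hB) h₂ hD hE hCE hR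

end Summit.AtomisticToContinuum.Crystallization.Theorems.OverbindingBudgetCleanTwoShellCut
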